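import Summits.CriticalPhenomena.SAWScalingLimit.Theorems.SAWDefectDecoherenceBoundaryClosureRZigzagDiscretisationCorner
import HarnessLib

/-!
# Crux `BoundaryClosureR` (stmt-CriticalPhenomena-14004), line `polygon-parity-squeeze`,
# stub `stub_innerPolygonsOfZigzag` (7b): the trimmed discretisation is an exact polygon family

Landing target:
`Summits/CriticalPhenomena/SAWScalingLimit/Theorems/SAWDefectDecoherenceBoundaryClosureRZigzagDiscretisationExact.lean`
(`--supports stmt-CriticalPhenomena-14004`; building block of the registered stub
`stub_innerPolygonsOfZigzag`, the lattice half of the inner-polygon construction (IP)).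

The eventual clause of `ExactPolygonFamily P Λ^P` with the corner set `Cor` and the radius `r/2`:

* `eventually_isCornerAt` — at a corner `c`, `IsCornerAt P (Λ^P_δ) δ c (r/2)` with the chart `κ c` and
  the thresholds `zdT k c`, `zdT k' c` (from the local characterisation near a corner);
* `eventually_isFlatSideAt` — at a frontier point `z` that is `r/2`-far from the corners,
  `IsFlatSideAt P (Λ^P_δ) δ z (r/4)`: if `z` is `r`-far this is the local characterisation near the
  flat chart; otherwise `z` lies on a ray of the corner `c` within `r`, at distance `≥ r/2`, the ball
  `ball z (r/4)` sees only the ray's half-plane (the other line is `≥ (√3/4)r > r/4` away) and the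
  corner condition reduces there to the single test of the ray's form (the other form passes with
  margin `0.17r` at a convex corner, fails with that margin at a reflex one).

Sources: folklore.  No proposition is defined and no named fact is introduced.
-/

noncomputable section

open scoped ComplexConjugate Topology
open Set Metric Filter
open Literature.Probability.LatticeModels Literature.Probability.RandomPlanarGeometry
  Literature.Probability.RandomPlanarGeometry.SAW
open Summit.CriticalPhenomena.SAWScalingLimit.Theorems.PolygonParitySqueeze.InnerZigzag
  (level_split level_add_smul halfPlane_eq_of_level_eq_zero)

namespace Summit.CriticalPhenomena.SAWScalingLimit.Theorems.PolygonParitySqueeze.ZigzagDiscretisation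

section Exact

variable {D P : DobrushinDomain} {Cor : Finset ℂ} {κ : ℂ → Fin 6 × Fin 6 × Bool}
  {r ρ r₁ r₀ : ℝ} {Λ : ℝ → Finset HexVertex} {m m₀ : ℝ → ℤ} {a b : ℝ → Sym2 HexVertex}

/-- **Eventually every corner is a lattice corner of radius `r/2`.** [folklore] -/
theorem eventually_isCornerAt
    (hA : AdmissibleFamily D ρ Λ m b) (hP : PinnedFlatRoot D Λ b (D.pt 0) a r₀ m₀)
    (hSD : P.carrier ⊆ D.carrier) (hr : 0 < r) (hrρ : r ≤ ρ / 16) (hrr₁ : r ≤ r₁ / 16) (hr₁r₀ : r₁ ≤ r₀)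
    (hD0 : D.carrier ∩ ball (D.pt 0) r₁ = {z : ℂ | (D.pt 0).im < z.im} ∩ ball (D.pt 0) r₁)
    (hF : ∀ w ∈ frontier P.carrier, w ∉ ball (D.pt 1) (15 * ρ / 16) → w ∉ ball (D.pt 0) (15 * r₁ / 16) → w ∈ D.carrier)
    (hdist : ρ + r₁ ≤ dist (D.pt 0) (D.pt 1))
    (hCor : ∀ c ∈ Cor, c ∈ frontier P.carrier)
    (hsep : ∀ c ∈ Cor, ∀ c' ∈ Cor, c ≠ c' → 4 * r ≤ dist c c')
    (hflat : ∀ z ∈ frontier P.carrier, (∀ c ∈ Cor, r ≤ dist z c) →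
      ∃ k : Fin 6, P.carrier ∩ ball z (r / 2) = halfPlane k z ∩ ball z (r / 2))
    (Hκ : ∀ c ∈ Cor, ((κ c).2.2 = true ∧ P.carrier ∩ ball c (2 * r) = halfPlane (κ c).1 c ∩ halfPlane (κ c).2.1 c ∩ ball c (2 * r)) ∨
      ((κ c).2.2 = false ∧ P.carrier ∩ ball c (2 * r) = (halfPlane (κ c).1 c ∪ halfPlane (κ c).2.1 c) ∩ ball c (2 * r))) :
    ∀ᶠ δ : ℝ in 𝓝[>] 0, ∀ c ∈ Cor, IsCornerAt P (zdLam P.carrier Cor κ r (D.pt 1) (D.pt 0) ρ r₁ Λ m m₀ δ) δ c (r / 2) := by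
  have hiff := eventually_zdLam_iff_corner hA hP P.isOpen hSD hr hrρ hrr₁ hr₁r₀ hD0 hF hdist hCor hsep hflat Hκ
  have hthr := eventually_zdThr_le_zdT hA hP ρ r₁
  filter_upwards [hiff, hthr, self_mem_nhdsWithin] with δ hiffδ hthrδ hδ c hc
  replace hδ : 0 < δ := hδ
  have hsmall : ball c (r / 2) ⊆ ball c (2 * r) := ball_subset_ball (by linarith)
  set T := zdT (D.pt 1) (D.pt 0) ρ r₁ (m δ) (m₀ δ) δ with hT
  refine ⟨(κ c).1, (κ c).2.1, T (κ c).1 c, T (κ c).2.1 c, ?_⟩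
  rcases Hκ c hc with ⟨hb, hch⟩ | ⟨hb, hch⟩
  · refine Or.inl ⟨inter_eq_inter_of_subset hch hsmall, fun v hv => ?_⟩
    have hv' : (δ : ℂ) * hexCenter v ∈ ball c (3 * r / 2) := ball_subset_ball (by linarith) hv
    rw [hiffδ c hc v hv', hb]
    constructor
    · rintro ⟨-, h, -⟩; exact h rfl
    · rintro ⟨h1, h2⟩
      refine ⟨?_, fun _ => ⟨h1, h2⟩, fun h => absurd h (by decide)⟩
      have : (δ : ℂ) * hexCenter v ∈ halfPlane (κ c).1 c ∩ halfPlane (κ c).2.1 c ∩ ball c (2 * r) :=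
        ⟨⟨mem_halfPlane_of_zdThr_le _ c hδ v ((hthrδ _ c).trans h1), mem_halfPlane_of_zdThr_le _ c hδ v ((hthrδ _ c).trans h2)⟩,
          hsmall hv⟩
      rw [← hch] at this; exact this.1
  · refine Or.inr ⟨inter_eq_inter_of_subset hch hsmall, fun v hv => ?_⟩
    have hv' : (δ : ℂ) * hexCenter v ∈ ball c (3 * r / 2) := ball_subset_ball (by linarith) hv
    rw [hiffδ c hc v hv', hb]
    constructor
    · rintro ⟨-, -, h⟩; exact h rfl
    · intro h12
      refine ⟨?_, fun h => absurd h (by decide), fun _ => h12⟩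
      have : (δ : ℂ) * hexCenter v ∈ (halfPlane (κ c).1 c ∪ halfPlane (κ c).2.1 c) ∩ ball c (2 * r) := by
        refine ⟨?_, hsmall hv⟩
        rcases h12 with h | h
        · exact Or.inl (mem_halfPlane_of_zdThr_le _ c hδ v ((hthrδ _ c).trans h))
        · exact Or.inr (mem_halfPlane_of_zdThr_le _ c hδ v ((hthrδ _ c).trans h))
      rw [← hch] at this; exact this.1

/-- **Flat side at a ray point of a corner, one mesh** (chart part + lattice part), for a corner chart
written with the ray's form `k₁` first: `z` on the line of `k₁` at distance `∈ [r/2, r)` from `c`.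
[folklore] -/
theorem flatSide_of_ray {S : Set ℂ} {Λ' : Finset HexVertex} {k₁ k₂ : Fin 6} {bb : Bool} {c z : ℂ} {r δ μ : ℝ}
    {T : Fin 6 → ℂ → ℤ} (hδ : 0 < δ)
    (hch : (bb = true ∧ S ∩ ball c (2 * r) = halfPlane k₁ c ∩ halfPlane k₂ c ∩ ball c (2 * r)) ∨
      (bb = false ∧ S ∩ ball c (2 * r) = (halfPlane k₁ c ∪ halfPlane k₂ c) ∩ ball c (2 * r)))
    (hzc : dist z c < r) (hzc2 : r / 2 ≤ dist z c) (h0 : ((z - c) * conj (innerNormal k₁)).re = 0)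
    (hconv : bb = true → k₂ ≠ k₁ → ((z - c) * conj (innerNormal k₂)).re = Real.sqrt 3 / 2 * ‖z - c‖)
    (hrefl : bb = false → k₂ ≠ k₁ → ((z - c) * conj (innerNormal k₂)).re = -(Real.sqrt 3 / 2 * ‖z - c‖))
    (hthr : ∀ k : Fin 6, zdThr k c δ ≤ T k c)
    (hpass : ∀ (k : Fin 6) (v : HexVertex), μ < (((δ : ℂ) * hexCenter v - c) * conj (innerNormal k)).re → T k c ≤ zigzagForm k v)
    (hfail : ∀ (k : Fin 6) (v : HexVertex), (((δ : ℂ) * hexCenter v - c) * conj (innerNormal k)).re ≤ -μ → ¬ T k c ≤ zigzagForm k v)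
    (hμr : μ ≤ r / 16)
    (hiff : ∀ v : HexVertex, (δ : ℂ) * hexCenter v ∈ ball c (3 * r / 2) →
      (v ∈ Λ' ↔ ((δ : ℂ) * hexCenter v ∈ S ∧ (bb = true → T k₁ c ≤ zigzagForm k₁ v ∧ T k₂ c ≤ zigzagForm k₂ v) ∧
        (bb = false → T k₁ c ≤ zigzagForm k₁ v ∨ T k₂ c ≤ zigzagForm k₂ v)))) :
    S ∩ ball z (r / 4) = halfPlane k₁ z ∩ ball z (r / 4) ∧
      ∀ v : HexVertex, (δ : ℂ) * hexCenter v ∈ ball z (r / 4) → (v ∈ Λ' ↔ T k₁ c ≤ zigzagForm k₁ v) := by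
  have hs := sqrt_three_div_two_gt
  have hzcr : r / 2 ≤ ‖z - c‖ := by rwa [← dist_eq_norm]
  have hsmall : ball z (r / 4) ⊆ ball c (2 * r) := by
    intro y hy; rw [mem_ball] at hy ⊢
    calc dist y c ≤ dist y z + dist z c := dist_triangle _ _ _
      _ < r / 4 + r := by linarith
      _ < 2 * r := by linarith
  have hsmall' : ball z (r / 4) ⊆ ball c (3 * r / 2) := by
    intro y hy; rw [mem_ball] at hy ⊢
    calc dist y c ≤ dist y z + dist z c := dist_triangle _ _ _
      _ < r / 4 + r := by linarith
      _ < 3 * r / 2 := by linarith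
  have hk1cz : halfPlane k₁ c = halfPlane k₁ z := halfPlane_eq_of_level_eq_zero k₁ h0
  have lev2 : ∀ y ∈ ball z (r / 4), ∀ s : ℝ, ((z - c) * conj (innerNormal k₂)).re = s →
      |((y - c) * conj (innerNormal k₂)).re - s| < r / 4 := by
    intro y hy s hs'
    rw [level_split (innerNormal k₂) y c z, hs', add_sub_cancel_right]
    have h1 := abs_level_le_dist k₂ z y
    rw [mem_ball] at hy
    linarith
  -- membership in `S` of a face above the threshold of `k₁` whose scaled centre is in the model
  have memS : ∀ v : HexVertex, (δ : ℂ) * hexCenter v ∈ ball z (r / 4) → T k₁ c ≤ zigzagForm k₁ v →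
      (bb = true → (δ : ℂ) * hexCenter v ∈ halfPlane k₂ c) → (δ : ℂ) * hexCenter v ∈ S := by
    intro v hv hT h2
    have h1 : (δ : ℂ) * hexCenter v ∈ halfPlane k₁ c := mem_halfPlane_of_zdThr_le k₁ c hδ v ((hthr k₁).trans hT)
    rcases hch with ⟨hb, hch⟩ | ⟨hb, hch⟩
    · have : (δ : ℂ) * hexCenter v ∈ halfPlane k₁ c ∩ halfPlane k₂ c ∩ ball c (2 * r) := ⟨⟨h1, h2 hb⟩, hsmall hv⟩
      rw [← hch] at this; exact this.1
    · have : (δ : ℂ) * hexCenter v ∈ (halfPlane k₁ c ∪ halfPlane k₂ c) ∩ ball c (2 * r) := ⟨Or.inl h1, hsmall hv⟩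
      rw [← hch] at this; exact this.1
  by_cases heq : k₂ = k₁
  · subst heq
    have hchart : S ∩ ball z (r / 4) = halfPlane k₂ z ∩ ball z (r / 4) := by
      rcases hch with ⟨-, hch⟩ | ⟨-, hch⟩
      · rw [inter_self] at hch; rw [inter_eq_inter_of_subset hch hsmall, hk1cz]
      · rw [union_self] at hch; rw [inter_eq_inter_of_subset hch hsmall, hk1cz]
    refine ⟨hchart, fun v hv => ?_⟩
    rw [hiff v (hsmall' hv)]
    constructor
    · rintro ⟨-, h1, h2⟩
      cases bb
      · exact (h2 rfl).elim id id
      · exact (h1 rfl).1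
    · intro hT
      refine ⟨memS v hv hT fun _ => mem_halfPlane_of_zdThr_le _ c hδ v ((hthr _).trans hT),
        fun _ => ⟨hT, hT⟩, fun _ => Or.inl hT⟩
  rcases hch with ⟨hb, hch⟩ | ⟨hb, hch⟩
  · -- convex corner: the ball lies inside the other half-plane with margin
    have hl := hconv hb heq
    have in2 : ∀ y ∈ ball z (r / 4), μ < ((y - c) * conj (innerNormal k₂)).re := by
      intro y hy
      have := lev2 y hy _ hl
      rw [abs_lt] at this
      nlinarith
    have hμ0 : 0 ≤ μ ∨ μ < 0 := le_or_gt 0 μ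
    have in2' : ∀ y ∈ ball z (r / 4), y ∈ halfPlane k₂ c := by
      intro y hy
      have := lev2 y hy _ hl
      rw [abs_lt] at this
      rw [mem_halfPlane_iff_level]
      nlinarith
    have hchart : S ∩ ball z (r / 4) = halfPlane k₁ z ∩ ball z (r / 4) := by
      ext y
      constructor
      · rintro ⟨hyS, hyB⟩
        have : y ∈ S ∩ ball c (2 * r) := ⟨hyS, hsmall hyB⟩
        rw [hch] at this
        exact ⟨hk1cz ▸ this.1.1, hyB⟩
      · rintro ⟨hy1, hyB⟩
        have : y ∈ halfPlane k₁ c ∩ halfPlane k₂ c ∩ ball c (2 * r) := ⟨⟨hk1cz ▸ hy1, in2' y hyB⟩, hsmall hyB⟩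
        rw [← hch] at this
        exact ⟨this.1, hyB⟩
    refine ⟨hchart, fun v hv => ?_⟩
    rw [hiff v (hsmall' hv), hb]
    constructor
    · rintro ⟨-, h1, -⟩; exact (h1 rfl).1
    · intro hT
      have hch' : (bb = true ∧ S ∩ ball c (2 * r) = halfPlane k₁ c ∩ halfPlane k₂ c ∩ ball c (2 * r)) ∨
          (bb = false ∧ S ∩ ball c (2 * r) = (halfPlane k₁ c ∪ halfPlane k₂ c) ∩ ball c (2 * r)) := Or.inl ⟨hb, hch⟩
      refine ⟨?_, fun _ => ⟨hT, hpass k₂ v (in2 _ hv)⟩, fun h => absurd h (by decide)⟩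
      have h1 : (δ : ℂ) * hexCenter v ∈ halfPlane k₁ c := mem_halfPlane_of_zdThr_le k₁ c hδ v ((hthr k₁).trans hT)
      have : (δ : ℂ) * hexCenter v ∈ halfPlane k₁ c ∩ halfPlane k₂ c ∩ ball c (2 * r) := ⟨⟨h1, in2' _ hv⟩, hsmall hv⟩
      rw [← hch] at this; exact this.1
  · -- reflex corner: the ball misses the other half-plane with margin
    have hl := hrefl hb heq
    have out2 : ∀ y ∈ ball z (r / 4), ((y - c) * conj (innerNormal k₂)).re ≤ -μ := by
      intro y hy
      have := lev2 y hy _ hl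
      rw [abs_lt] at this
      nlinarith
    have out2' : ∀ y ∈ ball z (r / 4), y ∉ halfPlane k₂ c := by
      intro y hy h
      have := lev2 y hy _ hl
      rw [abs_lt] at this
      have h' := (mem_halfPlane_iff_level k₂ c y).1 h
      nlinarith
    have hchart : S ∩ ball z (r / 4) = halfPlane k₁ z ∩ ball z (r / 4) := by
      ext y
      constructor
      · rintro ⟨hyS, hyB⟩
        have : y ∈ S ∩ ball c (2 * r) := ⟨hyS, hsmall hyB⟩
        rw [hch] at this
        rcases this.1 with h | h
        · exact ⟨hk1cz ▸ h, hyB⟩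
        · exact absurd h (out2' y hyB)
      · rintro ⟨hy1, hyB⟩
        have : y ∈ (halfPlane k₁ c ∪ halfPlane k₂ c) ∩ ball c (2 * r) := ⟨Or.inl (hk1cz ▸ hy1), hsmall hyB⟩
        rw [← hch] at this
        exact ⟨this.1, hyB⟩
    refine ⟨hchart, fun v hv => ?_⟩
    rw [hiff v (hsmall' hv), hb]
    constructor
    · rintro ⟨-, -, h2⟩
      rcases h2 rfl with h | h
      · exact h
      · exact absurd h (hfail k₂ v (out2 _ hv))
    · intro hT
      refine ⟨?_, fun h => absurd h (by decide), fun _ => Or.inl hT⟩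
      have h1 : (δ : ℂ) * hexCenter v ∈ halfPlane k₁ c := mem_halfPlane_of_zdThr_le k₁ c hδ v ((hthr k₁).trans hT)
      have : (δ : ℂ) * hexCenter v ∈ (halfPlane k₁ c ∪ halfPlane k₂ c) ∩ ball c (2 * r) := ⟨Or.inl h1, hsmall hv⟩
      rw [← hch] at this; exact this.1

/-- **Eventually every `r/2`-far frontier point is a flat side point of radius `r/4`.** [folklore] -/
theorem eventually_isFlatSideAt
    (hA : AdmissibleFamily D ρ Λ m b) (hP : PinnedFlatRoot D Λ b (D.pt 0) a r₀ m₀)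
    (hSD : P.carrier ⊆ D.carrier) (hr : 0 < r) (hrρ : r ≤ ρ / 16) (hrr₁ : r ≤ r₁ / 16) (hr₁r₀ : r₁ ≤ r₀)
    (hD0 : D.carrier ∩ ball (D.pt 0) r₁ = {z : ℂ | (D.pt 0).im < z.im} ∩ ball (D.pt 0) r₁)
    (hF : ∀ w ∈ frontier P.carrier, w ∉ ball (D.pt 1) (15 * ρ / 16) → w ∉ ball (D.pt 0) (15 * r₁ / 16) → w ∈ D.carrier)
    (hdist : ρ + r₁ ≤ dist (D.pt 0) (D.pt 1))
    (hCor : ∀ c ∈ Cor, c ∈ frontier P.carrier)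
    (hsep : ∀ c ∈ Cor, ∀ c' ∈ Cor, c ≠ c' → 4 * r ≤ dist c c')
    (hflat : ∀ z ∈ frontier P.carrier, (∀ c ∈ Cor, r ≤ dist z c) →
      ∃ k : Fin 6, P.carrier ∩ ball z (r / 2) = halfPlane k z ∩ ball z (r / 2))
    (Hκ : ∀ c ∈ Cor, ((κ c).2.2 = true ∧ P.carrier ∩ ball c (2 * r) = halfPlane (κ c).1 c ∩ halfPlane (κ c).2.1 c ∩ ball c (2 * r)) ∨
      ((κ c).2.2 = false ∧ P.carrier ∩ ball c (2 * r) = (halfPlane (κ c).1 c ∪ halfPlane (κ c).2.1 c) ∩ ball c (2 * r))) :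
    ∀ᶠ δ : ℝ in 𝓝[>] 0, ∀ z ∈ frontier P.carrier, (∀ c ∈ Cor, r / 2 ≤ dist z c) →
      IsFlatSideAt P (zdLam P.carrier Cor κ r (D.pt 1) (D.pt 0) ρ r₁ Λ m m₀ δ) δ z (r / 4) := by
  have hiffs := eventually_zdLam_iff_side hA hP P.isOpen hSD hr hrρ hrr₁ hr₁r₀ hD0 hF hdist hCor hsep hflat Hκ
  have hiffc := eventually_zdLam_iff_corner hA hP P.isOpen hSD hr hrρ hrr₁ hr₁r₀ hD0 hF hdist hCor hsep hflat Hκ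
  have hthr := eventually_zdThr_le_zdT hA hP ρ r₁
  have hfloat := eventually_delta_mul_float_le hA hP (show (0 : ℝ) < r / 32 by positivity)
  have hδ1 : ∀ᶠ δ : ℝ in 𝓝[>] 0, δ ∈ Ioo (0 : ℝ) (r / 32) := Ioo_mem_nhdsGT (by positivity)
  filter_upwards [hiffs, hiffc, hthr, hfloat, hδ1] with δ hiffsδ hiffcδ hthrδ hflδ hδδ z hzF hfar2
  obtain ⟨hδ, hδr⟩ := hδδ
  set x₁ := D.pt 1
  set x₀ := D.pt 0
  set T := zdT x₁ x₀ ρ r₁ (m δ) (m₀ δ) δ with hT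
  by_cases hfar : ∀ c ∈ Cor, r ≤ dist z c
  · -- `r`-far: the flat chart itself
    obtain ⟨k, hk⟩ := hflat z hzF hfar
    refine ⟨k, T k z, inter_eq_inter_of_subset hk (ball_subset_ball (by linarith)), fun v hv => ?_⟩
    have hv' : (δ : ℂ) * hexCenter v ∈ ball z (3 * r / 8) := ball_subset_ball (by linarith) hv
    rw [hiffsδ z hzF hfar k hk v hv']
    constructor
    · exact fun h => h.2
    · intro h
      refine ⟨?_, h⟩
      have : (δ : ℂ) * hexCenter v ∈ halfPlane k z ∩ ball z (r / 2) :=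
        ⟨mem_halfPlane_of_zdThr_le k z hδ v ((hthrδ k z).trans h), ball_subset_ball (by linarith) hv⟩
      rw [← hk] at this; exact this.1
  · -- on a ray of the corner `c` within `r`
    push Not at hfar
    obtain ⟨c, hc, hzc⟩ := hfar
    have hzc2 := hfar2 c hc
    have hzB : z ∈ ball c (2 * r) := mem_ball.2 (by linarith)
    have hzne : z ≠ c := by intro h; rw [h, dist_self] at hzc2; linarith
    have hno := corner_not_opposite hr hCor hsep hflat Hκ hc
    have hno' : (innerNormal (κ c).2.1 * conj (innerNormal (κ c).1)).re ≠ -1 := by rwa [inner_innerNormal_comm]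
    -- margin data at `c`
    set U : ℤ := |m δ - zdThr 0 x₁ δ| + |m₀ δ - zdThr 0 x₀ δ| + 2 with hU
    have hU0 : (0 : ℝ) ≤ U := by
      have h1 := abs_nonneg (m δ - zdThr 0 x₁ δ); have h2 := abs_nonneg (m₀ δ - zdThr 0 x₀ δ)
      have : (0 : ℤ) ≤ U := by rw [hU]; linarith
      exact_mod_cast this
    have hmargin := margin_le_of_small hδ hδr.le hflδ hU0
    set μ : ℝ := δ * (Real.sqrt 3 / 6 + Real.sqrt 3 / 2 * U) with hμ
    have hpassμ : ∀ (k : Fin 6) (v : HexVertex), μ < (((δ : ℂ) * hexCenter v - c) * conj (innerNormal k)).re →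
        T k c ≤ zigzagForm k v := fun k v h => zdT_le_of_lt_level x₁ x₀ ρ r₁ (m δ) (m₀ δ) hδ k c v h
    have hfailμ : ∀ (k : Fin 6) (v : HexVertex), (((δ : ℂ) * hexCenter v - c) * conj (innerNormal k)).re ≤ -μ →
        ¬ T k c ≤ zigzagForm k v := by
      intro k v h
      apply not_zdT_le_of_level_le x₁ x₀ ρ r₁ (m δ) (m₀ δ) hδ k c v
      have h3p : 0 < Real.sqrt 3 := Real.sqrt_pos.2 (by norm_num)
      have : δ * (Real.sqrt 3 / 2 * (U : ℝ)) ≤ μ := by rw [hμ]; nlinarith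
      linarith
    -- the statement for a chart written with the ray's form first
    have core : ∀ (k₁ k₂ : Fin 6) (bb : Bool),
        ((bb = true ∧ P.carrier ∩ ball c (2 * r) = halfPlane k₁ c ∩ halfPlane k₂ c ∩ ball c (2 * r)) ∨
          (bb = false ∧ P.carrier ∩ ball c (2 * r) = (halfPlane k₁ c ∪ halfPlane k₂ c) ∩ ball c (2 * r))) →
        (innerNormal k₁ * conj (innerNormal k₂)).re ≠ -1 →
        ((z - c) * conj (innerNormal k₁)).re = 0 →
        (∀ v : HexVertex, (δ : ℂ) * hexCenter v ∈ ball c (3 * r / 2) →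
          (v ∈ zdLam P.carrier Cor κ r x₁ x₀ ρ r₁ Λ m m₀ δ ↔ ((δ : ℂ) * hexCenter v ∈ P.carrier ∧
            (bb = true → T k₁ c ≤ zigzagForm k₁ v ∧ T k₂ c ≤ zigzagForm k₂ v) ∧
            (bb = false → T k₁ c ≤ zigzagForm k₁ v ∨ T k₂ c ≤ zigzagForm k₂ v)))) →
        IsFlatSideAt P (zdLam P.carrier Cor κ r x₁ x₀ ρ r₁ Λ m m₀ δ) δ z (r / 4) := by
      intro k₁ k₂ bb hch hno12 h0 hiffv
      have hconv : bb = true → k₂ ≠ k₁ → ((z - c) * conj (innerNormal k₂)).re = Real.sqrt 3 / 2 * ‖z - c‖ := by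
        intro hb hne
        rcases hch with ⟨-, hch⟩ | ⟨hb', -⟩
        · exact level_other_of_ray_inter hch hno12 hne hzF hzB hzne h0
        · rw [hb] at hb'; exact absurd hb' (by decide)
      have hrefl : bb = false → k₂ ≠ k₁ → ((z - c) * conj (innerNormal k₂)).re = -(Real.sqrt 3 / 2 * ‖z - c‖) := by
        intro hb hne
        rcases hch with ⟨hb', -⟩ | ⟨-, hch⟩
        · rw [hb] at hb'; exact absurd hb' (by decide)
        · exact level_other_of_ray_union hch hno12 hne hzF hzB hzne h0
      obtain ⟨hchart, hlat⟩ := flatSide_of_ray hδ hch hzc hzc2 h0 hconv hrefl (fun k => hthrδ k c) hpassμ hfailμ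
        hmargin hiffv
      exact ⟨k₁, T k₁ c, hchart, hlat⟩
    have hiffv := hiffcδ c hc
    rcases Hκ c hc with ⟨hb, hch⟩ | ⟨hb, hch⟩
    · rcases frontier_of_inter_chart hch hzF hzB with ⟨h0, -⟩ | ⟨h0, -⟩
      · exact core _ _ _ (Or.inl ⟨hb, hch⟩) hno h0 hiffv
      · rw [inter_comm (halfPlane (κ c).1 c)] at hch
        refine core _ _ _ (Or.inl ⟨hb, hch⟩) hno' h0 fun v hv => (hiffv v hv).trans ?_
        rw [and_comm (a := T (κ c).1 c ≤ zigzagForm (κ c).1 v), or_comm (a := T (κ c).1 c ≤ zigzagForm (κ c).1 v)]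
    · rcases frontier_of_union_chart hch hzF hzB with ⟨h0, -⟩ | ⟨h0, -⟩
      · exact core _ _ _ (Or.inr ⟨hb, hch⟩) hno h0 hiffv
      · rw [union_comm] at hch
        refine core _ _ _ (Or.inr ⟨hb, hch⟩) hno' h0 fun v hv => (hiffv v hv).trans ?_
        rw [and_comm (a := T (κ c).1 c ≤ zigzagForm (κ c).1 v), or_comm (a := T (κ c).1 c ≤ zigzagForm (κ c).1 v)]

end Exact

/-- **Flat side at a ray point of a corner, one mesh** (registered form, sub-goal of `stub_innerPolygonsOfZigzag`). [folklore] -/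
theorem zd_flatSide_of_ray : ∀ (S : Set ℂ) (Λ' : Finset HexVertex) (k₁ k₂ : Fin 6) (bb : Bool) (c z : ℂ) (r δ μ : ℝ) (T : Fin 6 → ℂ → ℤ), 0 < δ → ((bb = true ∧ S ∩ Metric.ball c (2 * r) = halfPlane k₁ c ∩ halfPlane k₂ c ∩ Metric.ball c (2 * r)) ∨ (bb = false ∧ S ∩ Metric.ball c (2 * r) = (halfPlane k₁ c ∪ halfPlane k₂ c) ∩ Metric.ball c (2 * r))) → dist z c < r → r / 2 ≤ dist z c → ((z - c) * (starRingEnd ℂ) (innerNormal k₁)).re = 0 → (bb = true → k₂ ≠ k₁ → ((z - c) * (starRingEnd ℂ) (innerNormal k₂)).re = Real.sqrt 3 / 2 * ‖z - c‖) → (bb = false → k₂ ≠ k₁ → ((z - c) * (starRingEnd ℂ) (innerNormal k₂)).re = -(Real.sqrt 3 / 2 * ‖z - c‖)) → (∀ k : Fin 6, zdThr k c δ ≤ T k c) → (∀ (k : Fin 6) (v : HexVertex), μ < (((δ : ℂ) * hexCenter v - c) * (starRingEnd ℂ) (innerNormal k)).re → T k c ≤ zigzagForm k v) → (∀ (k :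 Fin 6) (v : HexVertex), (((δ : ℂ) * hexCenter v - c) * (starRingEnd ℂ) (innerNormal k)).re ≤ -μ → ¬ T k c ≤ zigzagForm k v) → μ ≤ r / 16 → (∀ v : HexVertex, (δ : ℂ) * hexCenter v ∈ Metric.ball c (3 * r / 2) → (v ∈ Λ' ↔ ((δ : ℂ) * hexCenter v ∈ S ∧ (bb = true → T k₁ c ≤ zigzagForm k₁ v ∧ T k₂ c ≤ zigzagForm k₂ v) ∧ (bb = false → T k₁ c ≤ zigzagForm k₁ v ∨ T k₂ c ≤ zigzagForm k₂ v)))) → S ∩ Metric.ball z (r / 4) = halfPlane k₁ z ∩ Metric.ball z (r / 4) ∧ ∀ v : HexVertex, (δ : ℂ) * hexCenter v ∈ Metric.ball z (r / 4) → (v ∈ Λ' ↔ T k₁ c ≤ zigzagForm k₁ v) :=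
  fun _ _ _ _ _ _ _ _ _ _ _ hδ hch hzc hzc2 h0 hconv hrefl hthr hpass hfail hμr hiff => flatSide_of_ray hδ hch hzc hzc2 h0 hconv hrefl hthr hpass hfail hμr hiff

end Summit.CriticalPhenomena.SAWScalingLimit.Theorems.PolygonParitySqueeze.ZigzagDiscretisation

end
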